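/-
Copyright (c) 2026 the pub-hodgecm-mathlib formalisation cell (harness21).  Prover seat hodgecm-mathlib-B-p14 (g37), 2026-09-01.  «S3-ram» seeding wave (LEAD F0P3a-plan (g12)
T11-38∕T11-50; owner p06 (g15)): the tame-ramified twin of ★ `UnitaryThreeBoundaryRigidityLevelTwo` (architect A-83 «RIGID-2»), after the certificate «S3-ram (iv)»
(`CERT-S3ram-iv.B-p14g37.md` 446431ae: exact computation at q = 3, 5).
-/
import Literature.NumberTheory.Automorphic.UnitaryThreeBoundaryRigidityLevelTwo            -- ★ inert RIGID-2 (currency `IsIntMatrix`, `isIntMatrix_inv_smul_iff`, `unitaryGroupOfForm`, `StdForm.antidiagonal`)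
import Literature.GroupTheory.SpecificGroups.OrthogonalThreeUnipotentJordanClasses           -- ★ p846826 F0P3-p03 (g14): `eq_one_of_mem_orthogonal_of_sq_sub_one_eq_zero` (`O₃`, `2 ≠ 0`: no transvections)
import Literature.NumberTheory.Automorphic.UnitaryLatticeTreeResiduallyUnipotentCorner       -- ★ `residue_eq_zero_iff_v_lt_one`, `residue_eq_of_v_sub_lt_one` (`Valued` residue field)
import HarnessLib

/-!
# Boundary rigidity at level two at a TAMELY RAMIFIED place, I: the boundary of a deep element is residually regular (no transvection type)
# (Rogawski 1990 §3.9; Tits 1979 §3.5; Wilson 2009 §3.7.2)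

Topic `NumberTheory/Automorphic`; namespace `Literature.NumberTheory.Automorphic.UnitaryGroup`.  THEOREMS ONLY (no definition, no instance, no notation, no named fact, no `sorry`);
kernel lane.  Cell `pub/hodgecm-mathlib` (D-0151), crux H413 = `stmt-HodgeConjecture-24833`; «S3-ram» (the tame-ramified column of residue «S3-res»), LEAD T11-50 (1)(b): bytes of the
certificate's candidate statements.  SETTING: a valued field `K` (`Valued K ℤᵐ⁰`) with a ring endomorphism `σ` that is RESIDUALLY TRIVIAL on `𝒪` (`hres : |σx − x| < 1` for `|x| ≤ 1` —
the tame-ramified block ★ `ramifiedBlock_adicCompletion`; at an inert place `σ̄ = Frob ≠ id`), a uniformiser `ϖ` (`|ϖ| = exp(−1)`), `|2| = 1`; `J₀ = antidiag(1,1,1)`,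
`U = U(σ, J₀)` = ★ `unitaryGroupOfForm σ ((StdForm.antidiagonal 3).over K)`; «`≡ (mod ϖ)`» = ★ `IsIntMatrix (ϖ⁻¹ • (· − ·))`.

THE MATHEMATICS.  Reduce an integral `x ∈ U` entrywise to `x̄ ∈ M₃(𝓀)`: since `σ̄ = id`, `ᵗx̄ J̄₀ x̄ = J̄₀`, i.e. `x̄` lies in the ORTHOGONAL group `O(J̄₀)(𝓀)` (`det x̄ ≠ 0` from
`det J̄₀ ≠ 0`).  If `(x − 1)² ≡ 0 (mod ϖ)` then `(x̄ − 1)² = 0`, and ★ `eq_one_of_mem_orthogonal_of_sq_sub_one_eq_zero` (`O₃` over a field with `2 ≠ 0` has no transvections: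
the normal form `n(t)` needs `2t = 0`) gives `x̄ = 1`, i.e. `x ≡ 1 (mod ϖ)`.  CONSEQUENCE («S3-ram (iv)» verdict (2)): at a tamely ramified place a `γ`-fixed self-dual vertex of
local depth `0` is residually REGULAR — the transvection stratum of the inert boundary (★ `levelTwo_conj_cornerUnipotent_of_two_deep`) is EMPTY; the transvection phenomenon
lives at local depth `1` (the «collar», file II).

* §1 `residue_two_ne_zero_of_v_two_eq_one`, `det_over_antidiagonal_three_ne_zero` (bookkeeping);
* §2 **`isIntMatrix_smul_sub_one_of_sq_of_residual_trivial`** — `x ∈ U` integral, `(x − 1)² ≡ 0 (mod ϖ)` ⇒ `x ≡ 1 (mod ϖ)`.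

HONEST LABEL: HC_CM is proved only modulo the 2 remaining named inputs (hLiu418 24832, h413 24833) until rung 0 closes; elementary matrix algebra over a valued field; «S3-ram» is
Literature seeding, books unchanged.

## References
* [Rogawski1990] J. D. Rogawski, *Automorphic Representations of Unitary Groups in Three Variables*, Ann. of Math. Stud. 123 (1990), §3.9 p. 32, Prop. 3.9.1.
* [Tits1979] J. Tits, *Reductive groups over local fields*, PSPM 33.1 (1979), §3.5 (congruence filtration; special fibre of a parahoric).
* [Wilson2009] R. A. Wilson, *The Finite Simple Groups*, GTM 251 (2009), §3.7.2 (unipotent elements of orthogonal groups in odd characteristic).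
-/

set_option autoImplicit false

noncomputable section

open Matrix
open scoped Valued WithZero Matrix MatrixGroups

namespace Literature.NumberTheory.Automorphic.UnitaryGroup

open Literature.NumberTheory.Automorphic Literature.NumberTheory.Automorphic.HermitianLattice Literature.NumberTheory.Automorphic.UnitaryLatticeTree
open Literature.GroupTheory.SpecificGroups

variable {K : Type*} [Field K] [Valued K ℤᵐ⁰]

/-! ## §1 Bookkeeping: the residue of `2`, the determinant of `J₀` -/

/-- `|2| = 1 ⇒ 2 ≠ 0` in the residue field `𝓀[K]`. [cite: Tits1979, §3.5] -/
theorem residue_two_ne_zero_of_v_two_eq_one (h2 : Valued.v (2 : K) = 1) : (2 : 𝓀[K]) ≠ 0 := by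
  intro h
  have h' : IsLocalRing.residue 𝒪[K] 2 = 0 := by rw [map_ofNat]; exact h
  rw [residue_eq_zero_iff_v_lt_one] at h'
  have : Valued.v (2 : K) < 1 := by exact_mod_cast h'
  rw [h2] at this
  exact lt_irrefl _ this

/-- `det J₀ ≠ 0` over any field (`J₀ = antidiag(1,1,1)` is an involution). [folklore] -/
private theorem det_over_antidiagonal_three_ne_zero (F : Type*) [Field F] : ((StdForm.antidiagonal 3).over F).det ≠ 0 :=
  ((Matrix.isUnit_iff_isUnit_det _).1 ((StdForm.antidiagonal 3).isUnit_over F)).ne_zero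

/-! ## §2 No transvection-type boundary at a residually trivial involution -/

/-- **AT A TAMELY RAMIFIED PLACE THE BOUNDARY IS RESIDUALLY REGULAR — `(x − 1)² ≡ 0 (mod ϖ) ⇒ x ≡ 1 (mod ϖ)` for integral `x ∈ U(σ, J₀)` when `σ` is residually trivial and `|2| = 1`.**
The reduction `x̄` lies in `O(J̄₀)(𝓀)` (`σ̄ = id`), where `(x̄ − 1)² = 0` forces `x̄ = 1` (★ `eq_one_of_mem_orthogonal_of_sq_sub_one_eq_zero`: no transvections in `O₃`, `char ≠ 2`).  So the
hypothesis pair «`x ≢ 1 (mod ϖ)`, `(x − 1)² ≡ 0 (mod ϖ)`» of the inert transvection-type rigidity ★ `levelTwo_conj_cornerUnipotent_of_two_deep` is VACUOUS at a ramified place: every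
depth-`0` fixed vertex is of regular type (certificate «S3-ram (iv)»: 360 ∕ 400 boundary vertices at q = 3 ∕ 5, all regular). [cite: Rogawski1990, §3.9 p. 32] [cite: Tits1979, §3.5]
[cite: Wilson2009, §3.7.2] -/
theorem isIntMatrix_smul_sub_one_of_sq_of_residual_trivial {σ : K →+* K} {ϖ : K} (hϖ : Valued.v ϖ = WithZero.exp (-1 : ℤ))
    (hres : ∀ x : K, Valued.v x ≤ 1 → Valued.v (σ x - x) < 1) (h2 : Valued.v (2 : K) = 1)
    {x : GL (Fin 3) K} (hxU : x ∈ unitaryGroupOfForm σ ((StdForm.antidiagonal 3).over K)) (hxint : IsIntMatrix (x : Matrix (Fin 3) (Fin 3) K))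
    (hx2 : IsIntMatrix (ϖ⁻¹ • ((x : Matrix (Fin 3) (Fin 3) K) - 1) ^ 2)) :
    IsIntMatrix (ϖ⁻¹ • ((x : Matrix (Fin 3) (Fin 3) K) - 1)) := by
  classical
  have hϖ0 : ϖ ≠ 0 := fun h => by rw [h, map_zero] at hϖ; exact WithZero.zero_ne_coe hϖ
  have hϖ1 : Valued.v ϖ < 1 := by rw [hϖ, ← WithZero.exp_zero, WithZero.exp_lt_exp]; norm_num
  -- the integral avatars over `𝒪`
  have hσint : ∀ a : K, Valued.v a ≤ 1 → Valued.v (σ a) ≤ 1 := fun a ha => by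
    have h := Valuation.map_add_le_max' Valued.v (σ a - a) a
    rw [sub_add_cancel] at h
    exact h.trans (max_le (hres a ha).le ha)
  set π := IsLocalRing.residue 𝒪[K] with hπ
  set xO : Matrix (Fin 3) (Fin 3) 𝒪[K] := fun i j => ⟨(x : Matrix (Fin 3) (Fin 3) K) i j, hxint i j⟩ with hxO
  set xσO : Matrix (Fin 3) (Fin 3) 𝒪[K] := fun i j => ⟨σ ((x : Matrix (Fin 3) (Fin 3) K) i j), hσint _ (hxint i j)⟩ with hxσO
  set JO : Matrix (Fin 3) (Fin 3) 𝒪[K] := (StdForm.antidiagonal 3).over 𝒪[K] with hJO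
  have hcoe_inj : Function.Injective (fun M : Matrix (Fin 3) (Fin 3) 𝒪[K] => M.map ((𝒪[K]).subtype)) :=
    Matrix.map_injective Subtype.coe_injective
  have hxO_coe : xO.map ((𝒪[K]).subtype) = (x : Matrix (Fin 3) (Fin 3) K) := by ext i j; rfl
  have hxσO_coe : xσO.map ((𝒪[K]).subtype) = (x : Matrix (Fin 3) (Fin 3) K).map σ := by ext i j; rfl
  have hJO_coe : JO.map ((𝒪[K]).subtype) = (StdForm.antidiagonal 3).over K := StdForm.over_map _ _
  -- unitarity over `𝒪`
  have hUO : xσOᵀ * JO * xO = JO := by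
    apply hcoe_inj
    simp only [Matrix.map_mul, Matrix.transpose_map, hxO_coe, hxσO_coe, hJO_coe]
    exact mem_unitaryGroupOfForm_iff.1 hxU
  -- reduction: `σ̄ = id`
  have hred : xσO.map π = xO.map π := by
    ext i j
    simp only [Matrix.map_apply, hxσO, hxO]
    exact residue_eq_of_v_sub_lt_one (hres _ (hxint i j))
  set xb : Matrix (Fin 3) (Fin 3) 𝓀[K] := xO.map π with hxb
  have hJb : JO.map π = (StdForm.antidiagonal 3).over 𝓀[K] := StdForm.over_map _ _
  have hUb : xbᵀ * (StdForm.antidiagonal 3).over 𝓀[K] * xb = (StdForm.antidiagonal 3).over 𝓀[K] := by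
    have h := congrArg (fun M : Matrix (Fin 3) (Fin 3) 𝒪[K] => M.map π) hUO
    simp only [Matrix.map_mul, Matrix.transpose_map, hred, hJb] at h
    exact h
  -- `x̄` is invertible and orthogonal
  have hdetb : xb.det ≠ 0 := by
    intro h0
    have h := congrArg Matrix.det hUb
    rw [Matrix.det_mul, Matrix.det_mul, Matrix.det_transpose, h0, mul_zero] at h
    exact det_over_antidiagonal_three_ne_zero 𝓀[K] h.symm
  set u : GL (Fin 3) 𝓀[K] := Matrix.GeneralLinearGroup.mkOfDetNeZero xb hdetb with hu
  have huval : (u : Matrix (Fin 3) (Fin 3) 𝓀[K]) = xb := rfl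
  have huU : u ∈ unitaryGroupOfForm (RingHom.id 𝓀[K]) ((StdForm.antidiagonal 3).over 𝓀[K]) := by
    rw [mem_unitaryGroupOfForm_iff, huval, show xb.map (RingHom.id 𝓀[K]) = xb from by ext i j; rfl, hUb]
  -- `(x̄ − 1)² = 0`
  have hsqO : ((𝒪[K]).subtype).mapMatrix ((xO - 1) ^ 2) = ((x : Matrix (Fin 3) (Fin 3) K) - 1) ^ 2 := by
    rw [map_pow, map_sub, map_one, RingHom.mapMatrix_apply, hxO_coe]
  have hsqb : π.mapMatrix ((xO - 1) ^ 2) = (xb - 1) ^ 2 := by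
    rw [map_pow, map_sub, map_one, RingHom.mapMatrix_apply]
  have hsq : ((u : Matrix (Fin 3) (Fin 3) 𝓀[K]) - 1) * ((u : Matrix (Fin 3) (Fin 3) 𝓀[K]) - 1) = 0 := by
    rw [huval, ← sq, ← hsqb, RingHom.mapMatrix_apply]
    ext i j
    rw [Matrix.map_apply, Matrix.zero_apply, residue_eq_zero_iff_v_lt_one]
    have hij := (isIntMatrix_inv_smul_iff hϖ0 _).1 hx2 i j
    have hval : ((((xO - 1) ^ 2 : Matrix (Fin 3) (Fin 3) 𝒪[K]) i j : 𝒪[K]) : K) = (((x : Matrix (Fin 3) (Fin 3) K) - 1) ^ 2 : Matrix (Fin 3) (Fin 3) K) i j := by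
      rw [← hsqO, RingHom.mapMatrix_apply, Matrix.map_apply]; rfl
    rw [hval]
    exact hij.trans_lt hϖ1
  -- `O₃` has no transvections
  have hu1 : u = 1 := eq_one_of_mem_orthogonal_of_sq_sub_one_eq_zero (residue_two_ne_zero_of_v_two_eq_one h2) huU hsq
  have hxb1 : xb = 1 := by rw [← huval, hu1, Units.val_one]
  -- read back: `x ≡ 1 (mod ϖ)`
  have h0 : π.mapMatrix (xO - 1) = 0 := by rw [map_sub, map_one, RingHom.mapMatrix_apply, ← hxb, hxb1, sub_self]
  have hcoe1 : ((𝒪[K]).subtype).mapMatrix (xO - 1) = (x : Matrix (Fin 3) (Fin 3) K) - 1 := by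
    rw [map_sub, map_one, RingHom.mapMatrix_apply, hxO_coe]
  rw [isIntMatrix_inv_smul_iff hϖ0]
  intro i j
  rw [hϖ, ← v_lt_one_iff]
  have hij : π ((xO - 1 : Matrix (Fin 3) (Fin 3) 𝒪[K]) i j) = 0 := by
    have h := congrFun (congrFun h0 i) j
    rwa [RingHom.mapMatrix_apply, Matrix.map_apply, Matrix.zero_apply] at h
  rw [residue_eq_zero_iff_v_lt_one] at hij
  have hval : (((xO - 1 : Matrix (Fin 3) (Fin 3) 𝒪[K]) i j : 𝒪[K]) : K) = ((x : Matrix (Fin 3) (Fin 3) K) - 1) i j := by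
    rw [← hcoe1, RingHom.mapMatrix_apply, Matrix.map_apply]; rfl
  rwa [hval] at hij

end Literature.NumberTheory.Automorphic.UnitaryGroup

end
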